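import Summits.ResolutionOfSingularities.ResolutionOfSingularities.Theses.PAlteration
import Literature.AlgebraicGeometry.Resolution.ResolutionOfComponents
import Literature.Barriers.ResolutionOfSingularities.QuasiExcellenceNecessaryNagataProofs

/-!
# Negative lemma for crux `PicoverLocalModel` (stmt-ResolutionOfSingularities-0557): finite type
# over a field (excellence) is load-bearing — modulo one folklore link

Companion of `LoadBearing.lean` (same directory). The crux asks for a resolution of
`Spec (R[T]/(T^p - a))_red` for `R` a REGULAR FINITELY GENERATED `k`-DOMAIN. With
`Algebra.FiniteType k R` dropped the statement fails at every prime, at F. K. Schmidt's discrete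
valuation ring `S = K ∩ 𝔽_p⟦X⟧`, `K = 𝔽_p(X, f^p)` (`f ∈ X𝔽_p⟦X⟧` transcendental over `𝔽_p(X)`),
with `a = f^p`: `S` is regular, a domain, of characteristic `p`, and `S[T]/(T^p - a) ≅ S[f]` is a
one-dimensional Noetherian local domain whose normalization is NOT a finite module (Kollár 2007,
Example 1.103 / Claim 1.104, in tree: `Literature.Barriers.ResolutionOfSingularities.QuasiExcellence.
Nagata1962.*`, witnessed by Schmidt's ring). What is NOT in the tree (cf. the barrier entry
`QuasiExcellenceNecessary`, scope_caveats (c)) is the link, taken here as the explicit hypothesis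
`hL` of every theorem:

  *a one-dimensional Noetherian local domain `B` such that `Spec B` has a resolution in the weak
  sense `Scheme.HasResolution` has finite normalization.*

On paper: let `π : X' → Spec B` be proper birational with `X'` regular and `W` the normalization
(here a discrete valuation ring of `F = Frac B`, the extension being immediate); by the valuative
criterion `Spec W → X'` exists over `Spec B`; the local ring `C` of `X'` at the image of the closed
point is regular, hence normal (Matsumura 19.4, in tree), essentially of finite type over `B` and
— by birationality — a subring of `F` dominated by `W`; normality gives `W ⊆ C`, so `W = C` is a
localization of a finitely generated, integral, hence finite `B`-algebra at a maximal ideal, and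
being local it IS that algebra: finite. Formalising this needs the valuative-criterion / affine-
open / birational-restriction plumbing (Mathlib has `UniversallyClosed.eq_valuativeCriterion`);
left to a later cycle.

Contents: `liftAlgHom_injective`, `nonempty_localModelRing_equiv_adjoin` (the comparison
`(S[T]/(T^p - a))_red ≅ S[y]` for `y^p = a` of degree `p` over `Frac S`),
`not_hasResolution_localModel_of_nonFiniteIntegralClosure` (abstract form over any DVR with a
defect-`p` generator), `not_hasResolution_localModel_schmidt`,
`picoverLocalModel_false_without_finiteType_at` (every prime), `picoverLocalModel_false_without_finiteType`.
-/

noncomputable section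

open CategoryTheory AlgebraicGeometry TopologicalSpace Polynomial
open Literature.AlgebraicGeometry.Resolution
open Literature.Barriers.ResolutionOfSingularities.QuasiExcellence

set_option linter.dupNamespace false

namespace Summit.ResolutionOfSingularities.ResolutionOfSingularities.Theorems.PicoverLocalModel.Negative

/-! ## The comparison `(S[T]/(T^p - a))_red ≅ S[y]` and the counterexample -/

/-- If `ψ : S[T]/(g) →ₐ[S] F` into a field is injective then `(S[T]/(g))_red ≃ range ψ`.
[folklore] -/
theorem nonempty_ringEquiv_range_of_injective {S F : Type} [CommRing S] [Field F] [Algebra S F]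
    (g : S[X]) (ψ : AdjoinRoot g →ₐ[S] F) (hψ : Function.Injective ψ) :
    Nonempty ((AdjoinRoot g ⧸ nilradical (AdjoinRoot g)) ≃+* ψ.range) := by
  haveI : _root_.IsReduced (AdjoinRoot g) := by
    refine ⟨fun x hx => ?_⟩
    obtain ⟨n, hn⟩ := hx
    apply hψ
    rw [map_zero]
    have : ψ x ^ n = 0 := by rw [← map_pow, hn, map_zero]
    exact (pow_eq_zero_iff'.mp this).1
  exact ⟨((Ideal.quotEquivOfEq (nilradical_eq_zero (AdjoinRoot g))).trans
    (RingEquiv.quotientBot (AdjoinRoot g))).trans (AlgEquiv.ofInjective ψ hψ).toRingEquiv⟩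

/-- Injectivity criterion: `S ⊆ K ⊆ F`, `K` a field of fractions of `S`, `y ∈ F` with
`minpoly K y` of degree `deg g` for a monic `g ∈ S[T]` killing `y`; then `S[T]/(g) → F`, `T ↦ y`,
is injective (reduce a polynomial in the kernel modulo `g` and compare degrees over `K`).
[folklore] -/
theorem liftAlgHom_injective {S K F : Type} [CommRing S] [IsDomain S] [Field K] [Field F]
    [Algebra S K] [IsFractionRing S K] [Algebra K F] [Algebra S F] [IsScalarTower S K F]
    {g : S[X]} (hg : g.Monic) (y : F)
    (hy : g.eval₂ (Algebra.ofId S F : S →+* F) y = 0) (hmin : (minpoly K y).degree = g.degree) :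
    Function.Injective (AdjoinRoot.liftAlgHom g (Algebra.ofId S F) y hy) := by
  have hSK : Function.Injective (algebraMap S K) := IsFractionRing.injective S K
  rw [injective_iff_map_eq_zero]
  intro x hx
  rw [← AdjoinRoot.mk_leftInverse hg x] at hx ⊢
  set q := AdjoinRoot.modByMonicHom hg x with hq
  have hdeg : q.degree < g.degree := by
    obtain ⟨r, hr⟩ := AdjoinRoot.mk_surjective x
    rw [hq, ← hr, AdjoinRoot.modByMonicHom_mk]
    exact degree_modByMonic_lt r hg
  rw [AdjoinRoot.liftAlgHom_mk] at hx
  have hx' : aeval y (q.map (algebraMap S K)) = 0 := by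
    rw [aeval_map_algebraMap, aeval_def]
    exact hx
  by_cases hq0 : q.map (algebraMap S K) = 0
  · have : q = 0 :=
      (Polynomial.map_injective (algebraMap S K) hSK) (by rw [hq0, Polynomial.map_zero])
    rw [this, map_zero]
  · have h1 := minpoly.degree_le_of_ne_zero K y hq0 hx'
    have h2 : (q.map (algebraMap S K)).degree < g.degree := lt_of_le_of_lt degree_map_le hdeg
    rw [hmin] at h1
    exact absurd (lt_of_le_of_lt h1 h2) (lt_irrefl _)

/-- **Comparison.** `S ⊆ K ⊆ F`, `K = Frac S`, `a ∈ S`, `y ∈ F` with `y^p = a` and `minpoly K y`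
of degree `p`: then `(S[T]/(T^p - a))_red ≃ S[y] ⊆ F` (and `S[T]/(T^p - a)` is a domain).
[folklore] -/
theorem nonempty_localModelRing_equiv_adjoin {S : Type} (K : Type) {F : Type} [CommRing S]
    [IsDomain S] [Field K] [Field F] [Algebra S K] [IsFractionRing S K] [Algebra K F] [Algebra S F]
    [IsScalarTower S K F] {p : ℕ} (hp : 0 < p) (a : S) (y : F)
    (hypow : y ^ p = algebraMap S F a) (hmin : (minpoly K y).degree = p) :
    Nonempty ((AdjoinRoot (X ^ p - C a) ⧸ nilradical (AdjoinRoot (X ^ p - C a))) ≃+*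
      Algebra.adjoin S {y}) := by
  have hgm : ((X : S[X]) ^ p - C a).Monic := monic_X_pow_sub_C a hp.ne'
  have hgy : ((X : S[X]) ^ p - C a).eval₂ (Algebra.ofId S F : S →+* F) y = 0 := by
    rw [eval₂_sub, eval₂_X_pow, eval₂_C, hypow, sub_eq_zero]
    rfl
  set ψ := AdjoinRoot.liftAlgHom _ (Algebra.ofId S F) y hgy with hψ
  have hmin' : (minpoly K y).degree = ((X : S[X]) ^ p - C a).degree := by
    rw [degree_X_pow_sub_C hp, hmin]
  have hψinj : Function.Injective ψ := liftAlgHom_injective hgm y hgy hmin'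
  have hrange : ψ.range = Algebra.adjoin S {y} := by
    apply le_antisymm
    · rintro _ ⟨x, rfl⟩
      obtain ⟨q, rfl⟩ := AdjoinRoot.mk_surjective x
      change aeval y q ∈ Algebra.adjoin S {y}
      exact Polynomial.aeval_mem_adjoin_singleton _ y
    · rw [Algebra.adjoin_le_iff, Set.singleton_subset_iff]
      exact ⟨AdjoinRoot.root _, AdjoinRoot.liftAlgHom_root _ _ _ _⟩
  obtain ⟨e⟩ := nonempty_ringEquiv_range_of_injective _ ψ hψinj
  exact ⟨e.trans (Subalgebra.equivOfEq _ _ hrange).toRingEquiv⟩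

/-- **Abstract form of the counterexample (modulo the link `hL`).** Let `S` be a discrete valuation
ring with fraction field `K`, `F/K` an extension with power basis generated by `y`, `y^p = a ∈ 𝔪_S`,
`minpoly K y` of degree `p`, and suppose the integral closure of `S` in `F` is NOT a finite
`S`-module. Then `Spec (S[T]/(T^p - a))_red ≅ Spec S[y]` — the spectrum of a one-dimensional
Noetherian local domain with fraction field `F` (`Nagata1962.isLocalRing_adjoin`,
`ringKrullDim_subalgebra_eq_one`, `isFractionRing_subalgebra`) whose normalization is therefore not
finite — has no resolution in the weak sense, granted `hL`.
[cite: Kollar2007, Example 1.103 and Claim 1.104] -/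
theorem not_hasResolution_localModel_of_nonFiniteIntegralClosure {S K F : Type} [CommRing S]
    [IsDomain S] [IsDiscreteValuationRing S] [Field K] [Algebra S K] [IsFractionRing S K] [Field F]
    [Algebra K F] [Algebra S F] [IsScalarTower S K F] {p : ℕ} (hp : 0 < p) (a : S)
    (ha : a ∈ IsLocalRing.maximalIdeal S) (pb : PowerBasis K F)
    (hypow : pb.gen ^ p = algebraMap S F a) (hmin : (minpoly K pb.gen).degree = p)
    (hnf : ¬ Module.Finite S (integralClosure S F))
    (hL : ∀ (B : Type) [CommRing B] [IsDomain B] [IsNoetherianRing B] [IsLocalRing B],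
      ringKrullDim B = 1 → Scheme.HasResolution (Spec (.of B)) →
        Module.Finite B (integralClosure B (FractionRing B))) :
    ¬ Scheme.HasResolution
      (Spec (.of (AdjoinRoot (X ^ p - C a) ⧸ nilradical (AdjoinRoot (X ^ p - C a))))) := by
  set y := pb.gen with hy
  have hyint : IsIntegral S y := Nagata1962.isIntegral_of_pow_eq hp.ne' hypow
  set R := Algebra.adjoin S {y} with hR
  haveI : Module.Finite S R :=
    ⟨(Submodule.fg_top (Subalgebra.toSubmodule R)).mpr hyint.fg_adjoin_singleton⟩
  haveI : Algebra.IsIntegral S R := Algebra.IsIntegral.of_finite _ _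
  haveI : IsNoetherianRing R := Nagata1962.isNoetherianRing_subalgebra R
  haveI : IsLocalRing R := Nagata1962.isLocalRing_adjoin ha hypow
  have hinj : Function.Injective (algebraMap S F) := by
    rw [IsScalarTower.algebraMap_eq S K F]
    exact (algebraMap K F).injective.comp (IsFractionRing.injective S K)
  have hdim : ringKrullDim R = 1 := Nagata1962.ringKrullDim_subalgebra_eq_one R hinj
  haveI : IsFractionRing R F :=
    Nagata1962.isFractionRing_subalgebra pb R (Algebra.self_mem_adjoin_singleton _ _)
  obtain ⟨e'⟩ := nonempty_localModelRing_equiv_adjoin K hp a y hypow hmin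
  intro hres
  have hres' : Scheme.HasResolution (Spec (.of R)) :=
    hres.of_iso (Spec.map e'.symm.toCommRingCatIso.hom)
  exact hnf (Nagata1962.finite_integralClosure_of_tower R
    (Nagata1962.finite_integralClosure_of_isFractionRing (hL R hdim hres')))

section Schmidt

open IntermediateField
open scoped LaurentSeries PowerSeries

variable (p : ℕ) [hp : Fact p.Prime] (K : IntermediateField (ZMod p) (ZMod p)⸨X⸩) (f : (ZMod p)⟦X⟧)
variable (ht : (HahnSeries.single 1 1 : (ZMod p)⸨X⸩) ∈ K)
  (hzp : (f : (ZMod p)⸨X⸩) ^ p ∈ K) (hz : (f : (ZMod p)⸨X⸩) ∉ K)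
  (hvz : Valued.v (f : (ZMod p)⸨X⸩) < 1)

include ht hz hvz in
/-- **At F. K. Schmidt's discrete valuation ring the local model has no resolution** (modulo `hL`):
`S = K ∩ 𝔽_p⟦X⟧` for `K = 𝔽_p(X, f^p)`, `a = f^p ∈ 𝔪_S`, `F = K(f)`; the integral closure of `S`
in `F` is not finite (`Nagata1962.not_finite_integralClosure_adjoin`).
[cite: Kollar2007, Example 1.103 and Claim 1.104] -/
theorem not_hasResolution_localModel_schmidt
    (hL : ∀ (B : Type) [CommRing B] [IsDomain B] [IsNoetherianRing B] [IsLocalRing B],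
      ringKrullDim B = 1 → Scheme.HasResolution (Spec (.of B)) →
        Module.Finite B (integralClosure B (FractionRing B)))
    (a : (Valued.v.comap (algebraMap K (ZMod p)⸨X⸩)).valuationSubring)
    (ha : (a : K) = ⟨(f : (ZMod p)⸨X⸩) ^ p, hzp⟩) :
    ¬ Scheme.HasResolution
      (Spec (.of (AdjoinRoot (X ^ p - C a) ⧸ nilradical (AdjoinRoot (X ^ p - C a))))) := by
  haveI := Nagata1962.isDiscreteValuationRing p K ht
  letI : Algebra (Valued.v.comap (algebraMap K (ZMod p)⸨X⸩)).valuationSubring (↥K⟮(f : (ZMod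
      p)⸨X⸩)⟯) := ((algebraMap K (↥K⟮(f : (ZMod p)⸨X⸩)⟯)).comp (algebraMap (Valued.v.comap
      (algebraMap K (ZMod p)⸨X⸩)).valuationSubring K)).toAlgebra
  haveI : IsScalarTower (Valued.v.comap (algebraMap K (ZMod p)⸨X⸩)).valuationSubring K (↥K⟮(f :
      (ZMod p)⸨X⸩)⟯) := IsScalarTower.of_algebraMap_eq fun _ => rfl
  have ha' : a = ⟨⟨(f : (ZMod p)⸨X⸩) ^ p, hzp⟩, Nagata1962.pow_p_mem p K f hzp hvz⟩ := Subtype.ext ha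
  have hamem : a ∈ IsLocalRing.maximalIdeal _ := by
    rw [ha']
    exact Nagata1962.pow_p_mem_maximalIdeal p K f hzp hvz
  have hypow : (adjoin.powerBasis (Literature.AlgebraicGeometry.Resolution.SchmidtDefect.isIntegral_gen
      p K (f : (ZMod p)⸨X⸩) hzp)).gen ^ p = algebraMap (Valued.v.comap (algebraMap K (ZMod
        p)⸨X⸩)).valuationSubring (↥K⟮(f : (ZMod p)⸨X⸩)⟯) a := by
    rw [adjoin.powerBasis_gen, IsScalarTower.algebraMap_apply (Valued.v.comap (algebraMap K (ZMod
      p)⸨X⸩)).valuationSubring K (↥K⟮(f : (ZMod p)⸨X⸩)⟯)]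
    change _ = algebraMap K (↥K⟮(f : (ZMod p)⸨X⸩)⟯) (a : K)
    rw [ha]
    exact Nagata1962.gen_pow_eq p K f hzp
  have hmin : (minpoly K (adjoin.powerBasis
      (Literature.AlgebraicGeometry.Resolution.SchmidtDefect.isIntegral_gen p K (f : (ZMod p)⸨X⸩)
        hzp)).gen).degree = p := by
    rw [adjoin.powerBasis_gen, IntermediateField.minpoly_gen,
      Literature.AlgebraicGeometry.Resolution.SchmidtDefect.minpoly_gen p K (f : (ZMod p)⸨X⸩) hzp hz,
      degree_X_pow_sub_C hp.out.pos]
  exact not_hasResolution_localModel_of_nonFiniteIntegralClosure hp.out.pos a hamem _ hypow hmin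
    (Nagata1962.not_finite_integralClosure_adjoin p K f ht hzp hz) hL

/-- **At every prime the crux with `Algebra.FiniteType k R` dropped fails** (modulo `hL`):
`k = 𝔽_p`, `R = S` Schmidt's discrete valuation ring (regular, a domain, of characteristic `p`,
not of finite type over `𝔽_p`), `a = f^p`. [cite: Kollar2007, Example 1.103 and Claim 1.104] -/
theorem picoverLocalModel_false_without_finiteType_at
    (hL : ∀ (B : Type) [CommRing B] [IsDomain B] [IsNoetherianRing B] [IsLocalRing B],
      ringKrullDim B = 1 → Scheme.HasResolution (Spec (.of B)) →
        Module.Finite B (integralClosure B (FractionRing B))) :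
    ¬ ∀ (k : Type) [Field k] [CharP k p] (R : Type) [CommRing R] [IsDomain R]
      [Algebra k R], IsRegularRing R → ∀ a : R,
        Scheme.HasResolution
          (Spec (.of (AdjoinRoot (X ^ p - C a) ⧸ nilradical (AdjoinRoot (X ^ p - C a))))) := by
  intro h
  obtain ⟨f, K, ht, hzp, hz, hvz⟩ := Nagata1962.exists_data p
  haveI := Nagata1962.isDiscreteValuationRing p K ht
  haveI := Nagata1962.charP_valuationSubring p K
  letI : Algebra (ZMod p) (Valued.v.comap (algebraMap K (ZMod p)⸨X⸩)).valuationSubring :=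
    ZMod.algebra _ p
  exact not_hasResolution_localModel_schmidt p K f ht hzp hz hvz hL
    ⟨⟨(f : (ZMod p)⸨X⸩) ^ p, hzp⟩, Nagata1962.pow_p_mem p K f hzp hvz⟩ rfl
    (h (ZMod p) (Valued.v.comap (algebraMap K (ZMod p)⸨X⸩)).valuationSubring inferInstance _)

end Schmidt

/-- **Any proof of the crux must use `Algebra.FiniteType k R`** (excellence), granted the link
`hL`: the statement with that hypothesis dropped is false (already at `p = 2`).
[cite: Kollar2007, Example 1.103 and Claim 1.104] -/
theorem picoverLocalModel_false_without_finiteType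
    (hL : ∀ (B : Type) [CommRing B] [IsDomain B] [IsNoetherianRing B] [IsLocalRing B],
      ringKrullDim B = 1 → Scheme.HasResolution (Spec (.of B)) →
        Module.Finite B (integralClosure B (FractionRing B))) :
    ¬ ∀ p : ℕ, p.Prime → ∀ (k : Type) [Field k] [CharP k p] (R : Type) [CommRing R] [IsDomain R]
      [Algebra k R], IsRegularRing R → ∀ a : R,
        Scheme.HasResolution
          (Spec (.of (AdjoinRoot (X ^ p - C a) ⧸ nilradical (AdjoinRoot (X ^ p - C a))))) :=
  fun h =>
    haveI : Fact (Nat.Prime 2) := ⟨Nat.prime_two⟩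
    picoverLocalModel_false_without_finiteType_at 2 hL (h 2 Nat.prime_two)

end Summit.ResolutionOfSingularities.ResolutionOfSingularities.Theorems.PicoverLocalModel.Negative

end
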